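import Literature.MathematicalPhysics.QuantumFieldTheory.Balaban1983to89.B8Eq348CubeMemberFlatMatrixNorm

/-!
# `Balaban1983to89.B8Eq348CubeMemberKKT` — [Balaban1985BackgroundPropagators] (3.22)–(3.25) p. 394 ∕ Theorem 3.2 (3.48) p. 398 on the cube member:
# THE 𝒢-MULTIPLIER AS A LAGRANGE MULTIPLIER (`T²u = Qᵀμ`, `Qu = X`), THE SUPPORT OF THE CONSUMER'S ROWS, AND THE WALL ROWS OF `𝒢` BY LOCALITY

statement-level skeleton of published theorems with citation tags; proofs where landed; nothing here is a claim about the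
Yang–Mills mass gap

`[Balaban1985BackgroundPropagators]` ("[4]", CMP **99** (1985) 389–434) (3.22)–(3.25) p. 394 («H′X is the configuration minimizing ‖G′⁻¹λ‖² under the condition
Q′λ = X … H′ = G′²Q′*(Q′G′²Q′*)⁻¹»), Theorem 3.2 (3.48) p. 398; `[Balaban1985RegularSpaces]` ("B8") (1.91)–(1.92) p. 91; `[Balaban1984PropagatorsII]` ("B6")
(2.4) p. 224 («B⁰(Λ₀) = Λ₀»), (2.14) p. 225 («(Q′₀λ)(x) = λ(x), x ∈ Λ₀»).

CITATION HEADER (lean-in-tree rule).  Cell `pub-ymgap` (YM Track A, HUMAN RULING D-0062), DAG node N05 = [B8], seat `pub-ymgap-dag-n05-c` (g10; the (R1′) programme: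
the 𝒢-bound `B8Thm32GBoundCubeMember.GBoundCubeMemberPrinted` for the consumer `B8Prop6CubeMemberFlatScalar.prop6_cubeMember_flat_of_real` of n05-e).  This is the
CONSUMER-SIDE half of the exact transfer of the 𝒢-bound to p21's [B6] Prop. 2.3 on the level-`0` Neumann box (`B6Prop23MultiLevelBoxL0.prop23_multiLevelBox`, landed
2026-08-27): nothing here mentions the box; everything is algebra and lattice geometry of the consumer's explicit matrices `T = Matrix.of K`, `Q`.

WHAT THIS FILE PROVES (kernel-checked; consumer's generic letters `L, a, M, ρ, k, n, η, w, S, B, K, T, Q` as in `B8Eq192CubeMemberOfReal1G`).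
* §1 ★ `kkt_of_inverse` — for `μ := (QT⁻¹T⁻¹Qᵀ)⁻¹X` and `u := T⁻¹T⁻¹Qᵀμ`: `T(Tu) = Qᵀμ` and `Qu = X` ([4] (3.22)–(3.25): `u = H′X` and `μ = 𝒢X` solve the
  Lagrange system of «minimizing ‖G′⁻¹λ‖² under Q′λ = X»; pure matrix algebra from `TT⁻¹ = 1`, `MM⁻¹ = 1`, any index types).
* §2 ★ `K_support` — a non-zero entry `K(x,z)` forces `z = x`, or `z = x ± e_μ`, or `z` in the tower block of `x` (any restriction sets and weights);
  `abs_mulVec_le_rowAbs` (`|(Tv)(x)| ≤ (Σ_z|K(x,z)|)·m` once `|v| ≤ m` on the support of the row).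
* §3 lattice geometry of the collar: `abs_e_apply_le`, `mem_cube_zero_of_near_cube_one` (`□₁ + [−r,r]^{d+1} ⊂ □₀` for `r ≤ ρ`), ★ `good_of_K_ne_zero` (if the
  `2`-ball of `x` lies in `□₀`, every `z` in the support of the row `K(x,·)` has all its lattice neighbours in `□₀`), ★ `near_wall_dichotomy` (`ρ ≥ 4`: either the
  `2`-ball of `x` lies in `□₀`, or the `2`-ball of `x` misses `□₁`).
* §4 the tower letters: `Qt_mulVec_eq` (`(Qᵀg)(z) = L^{−(d+1)j}g(p)` at the tower `p ∋ z` — towers are disjoint, n05-e `towers_disjoint_cube`), `Q_mulVec_eq` (a row of `Q`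
  is the normalised block sum), ★ `Q_mulVec_level_zero` (AT A LEVEL-`0` TOWER `(0, y)` THE ROW OF `Q` IS THE POINT EVALUATION: `(Qf)(0,y) = f(y)` — [B6] «(Q′₀λ)(x) = λ(x)»).
* §5 ★★ `wall_rows_bound` — THE ROWS OF `T²` NEAR THE DIRICHLET WALL: if the `2`-ball of `x ∈ □₀` misses `□₁` and `u = X` on the level-`0` towers (the constraint
  `Qu = X` read at level `0`), then `|(T(Tu))(x)| ≤ ((4(d+1) + a_max)η⁻²)²·sup|X|` (two applications of F12 `flatKernel_rowAbs_le`; no inverse is met).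

HONEST SCOPE ∕ NOT CLAIMED.  Algebra, support bookkeeping and one trivial locality bound; no estimate of [4] is proved here; the 𝒢-bound stays OPEN until the
successor `B8Thm32GBoundCubeMemberHolds` (which feeds §1–§5 and p21's (2.87) into one proof).  Count-neutral; N05 NOT discharged; one finite `T⁴` programme at
fixed `ε`, Bałaban as printed; nothing continuum ∕ ℝ⁴ ∕ OS ∕ mass-gap ∕ Clay.  No `sorry`, no `def`, no `instance`, no `notation`.  Unit `pub-ymgap-dag-n05-c` (g10),
2026-08-27.

RELATED IN THE TREE, NOT DUPLICATED: `B8Eq192CubeMemberOfReal1G.real2_of_real1_gbound` (F6: the column collapse `hu_eq` is in-lined there; §4 states it once),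
`B8Eq348CubeMemberFlatMatrixNorm.flatKernel_rowAbs_le` (F12, USED), `B8CubeMemberBoxRows.K_row_sum` (F2: the row against a function; §2 is the support statement),
`B8Eq191FlatTowerGram.isUnit_towerGram` ∕ `B8Eq191FlatDirichletForm.isUnit_flatMatrix` (n05-e, the units fed to §1 by the successor),
`B8Eq191FlatLettersCubeMember.towers_disjoint_cube` (USED), `B8Eq131CubesAdmissible.add_mem_cube_of_mem_succ` (USED).
-/
noncomputable section

namespace Literature.MathematicalPhysics.QuantumFieldTheory.Balaban1983to89.B8Eq348CubeMemberKKT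

open scoped Matrix
open B7Prop1Explicit (e)
open B8Eq131Cubes (cube)
open B8Eq131CubesAdmissible (cubeFam cubeFam_false_of_le add_mem_cube_of_mem_succ)
open B8CubeMemberZd (cubeLamS)
open B8Eq191FlatLettersCubeMember (towers_disjoint_cube cubeFam_antitone)
open B8Eq191FlatDirichletDepth (mem_cube_of_tower)
open B8Eq348CubeMemberFlatMatrixNorm (flatKernel_rowAbs_le)
open Literature.MathematicalPhysics.QuantumLattice (blockMap)

variable {d : ℕ}

/-! ## §1 The Lagrange system of [4] (3.22)–(3.25): `μ = 𝒢X`, `u = H′X` -/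

/-- **THE 𝒢-MULTIPLIER IS A LAGRANGE MULTIPLIER** ([4] (3.22)–(3.25): `H′X` minimises `‖G′⁻¹λ‖²` under `Q′λ = X`, `H′ = G′²Q′*(Q′G′²Q′*)⁻¹`): for any square `T` with
`TT⁻¹ = 1` and any `Q` with `(QT⁻¹T⁻¹Qᵀ)(QT⁻¹T⁻¹Qᵀ)⁻¹ = 1`, the vectors `μ = (QT⁻¹T⁻¹Qᵀ)⁻¹X` and `u = T⁻¹T⁻¹Qᵀμ` satisfy `T(Tu) = Qᵀμ` and `Qu = X`.
[cite: Balaban1985BackgroundPropagators, (3.22)–(3.25) p.394; Balaban1985RegularSpaces, (1.91) p.91] -/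
theorem kkt_of_inverse {m n : Type*} [Fintype m] [Fintype n] [DecidableEq m] [DecidableEq n] (T : Matrix n n ℝ) (Q : Matrix m n ℝ)
    (hTT : T * T⁻¹ = 1) (hMM : (Q * T⁻¹ * T⁻¹ * Qᵀ) * (Q * T⁻¹ * T⁻¹ * Qᵀ)⁻¹ = 1) (X : m → ℝ) :
    T *ᵥ (T *ᵥ ((T⁻¹ * T⁻¹ * Qᵀ) *ᵥ ((Q * T⁻¹ * T⁻¹ * Qᵀ)⁻¹ *ᵥ X))) = Qᵀ *ᵥ ((Q * T⁻¹ * T⁻¹ * Qᵀ)⁻¹ *ᵥ X) ∧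
    Q *ᵥ ((T⁻¹ * T⁻¹ * Qᵀ) *ᵥ ((Q * T⁻¹ * T⁻¹ * Qᵀ)⁻¹ *ᵥ X)) = X := by
  constructor
  · rw [Matrix.mulVec_mulVec, Matrix.mulVec_mulVec]
    have h1 : ∀ W : Matrix n m ℝ, T * (T⁻¹ * W) = W := fun W => by rw [← Matrix.mul_assoc, hTT, Matrix.one_mul]
    have h : T * T * (T⁻¹ * T⁻¹ * Qᵀ) = Qᵀ := by
      calc T * T * (T⁻¹ * T⁻¹ * Qᵀ) = T * (T * (T⁻¹ * (T⁻¹ * Qᵀ))) := by simp only [Matrix.mul_assoc]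
        _ = Qᵀ := by rw [h1, h1]
    rw [h]
  · rw [Matrix.mulVec_mulVec, Matrix.mulVec_mulVec]
    have h : Q * (T⁻¹ * T⁻¹ * Qᵀ) * (Q * T⁻¹ * T⁻¹ * Qᵀ)⁻¹ = 1 := by
      rw [show Q * (T⁻¹ * T⁻¹ * Qᵀ) = Q * T⁻¹ * T⁻¹ * Qᵀ by simp only [Matrix.mul_assoc], hMM]
    rw [h, Matrix.one_mulVec]

/-! ## §2 The support of a row of the consumer's matrix `K` -/

open Classical in
/-- **THE SUPPORT OF A ROW OF `K`**: if `K(x,z) ≠ 0` then `z = x`, or `z = x ± e_μ` for some axis `μ`, or `z` lies in the tower block of `x` (`Bʲ(x)` a restriction block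
and `Bʲ(z) = Bʲ(x)`).  Any `L, η`, restriction sets `Λs`, weights `w`. [cite: Balaban1985RegularSpaces, (1.91) p.91 («Δ(·) + Q*aQ»); Balaban1984PropagatorsII, (2.13)–(2.14) p.225] -/
theorem K_support {η : ℝ} (L m : ℕ) (Λs : ℕ → Set (Fin (d + 1) → ℤ)) (w : ℕ → ℝ)
    (K : (Fin (d + 1) → ℤ) → (Fin (d + 1) → ℤ) → ℝ)
    (hK : ∀ x z, K x z = ((η ^ 2)⁻¹ * ∑ μ : Fin (d + 1), ((2 : ℝ) * (if z = x then (1 : ℝ) else 0) - (if z = x + e μ then (1 : ℝ) else 0)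
        - (if z = x - e μ then (1 : ℝ) else 0))) +
        (∑ j ∈ Finset.range (m + 1), (if blockMap (L ^ j) x ∈ Λs j ∧ blockMap (L ^ j) z = blockMap (L ^ j) x then
          w j * ((((L : ℝ) ^ (d + 1))⁻¹) ^ j) ^ 2 else 0)))
    {x z : Fin (d + 1) → ℤ} (h : K x z ≠ 0) :
    z = x ∨ (∃ μ : Fin (d + 1), z = x + e μ ∨ z = x - e μ) ∨
      (∃ j, j ≤ m ∧ blockMap (L ^ j) x ∈ Λs j ∧ blockMap (L ^ j) z = blockMap (L ^ j) x) := by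
  by_contra hc
  simp only [not_or, not_exists, not_and] at hc
  obtain ⟨h1, h2, h3⟩ := hc
  apply h
  rw [hK]
  have hlap : ∑ μ : Fin (d + 1), ((2 : ℝ) * (if z = x then (1 : ℝ) else 0) - (if z = x + e μ then (1 : ℝ) else 0)
      - (if z = x - e μ then (1 : ℝ) else 0)) = 0 := by
    refine Finset.sum_eq_zero fun μ _ => ?_
    rw [if_neg h1, if_neg (h2 μ).1, if_neg (h2 μ).2]; ring
  have hmass : ∑ j ∈ Finset.range (m + 1), (if blockMap (L ^ j) x ∈ Λs j ∧ blockMap (L ^ j) z = blockMap (L ^ j) x then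
      w j * ((((L : ℝ) ^ (d + 1))⁻¹) ^ j) ^ 2 else 0) = 0 := by
    refine Finset.sum_eq_zero fun j hj => ?_
    rw [if_neg]
    rintro ⟨ha, hb⟩
    exact h3 j (Nat.lt_succ_iff.mp (Finset.mem_range.mp hj)) ha hb
  rw [hlap, hmass, mul_zero, add_zero]

/-- **A ROW APPLIED TO A VECTOR BOUNDED ON THE ROW'S SUPPORT**: `|(Tv)(x)| ≤ (Σ_{z∈S}|K(x,z)|)·m` once `|v(z)| ≤ m` wherever `K(x,z) ≠ 0` (`T = Matrix.of K` on `S`).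
[folklore] [cite: Balaban1985BackgroundPropagators, (3.48) p.398 (the row-summed reading)] -/
theorem abs_mulVec_le_rowAbs (S : Finset (Fin (d + 1) → ℤ)) (K : (Fin (d + 1) → ℤ) → (Fin (d + 1) → ℤ) → ℝ)
    (T : Matrix ↥S ↥S ℝ) (hT : T = Matrix.of (fun x z : ↥S => K x.1 z.1)) (v : ↥S → ℝ) (m : ℝ) (x : ↥S)
    (hv : ∀ z : ↥S, K x.1 z.1 ≠ 0 → |v z| ≤ m) :
    |(T *ᵥ v) x| ≤ (∑ z ∈ S, |K x.1 z|) * m := by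
  rw [Matrix.mulVec, dotProduct, ← Finset.sum_coe_sort S (fun z => |K x.1 z|), Finset.sum_mul]
  refine (Finset.abs_sum_le_sum_abs _ _).trans (Finset.sum_le_sum fun z _ => ?_)
  rw [hT, Matrix.of_apply, abs_mul]
  by_cases hz : K x.1 z.1 = 0
  · rw [hz, abs_zero, zero_mul, zero_mul]
  · exact mul_le_mul_of_nonneg_left (hv z hz) (abs_nonneg _)

/-! ## §3 Lattice geometry of the collar `□₀ ∖ □₁` -/

/-- `|e_μ(i)| ≤ 1` for the lattice unit vectors `e_μ` of the forward differences. [folklore] [cite: Balaban1985RegularSpaces, (1.4) p.77 («e_μ»)] -/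
theorem abs_e_apply_le (μ i : Fin (d + 1)) : |(e μ : Fin (d + 1) → ℤ) i| ≤ 1 := by
  change |(Pi.single μ (1 : ℤ) : Fin (d + 1) → ℤ) i| ≤ 1
  rw [Pi.single_apply]
  split_ifs <;> simp

/-- **`□₁ + [−r, r]^{d+1} ⊂ □₀` for `r ≤ ρ`** (the collar `□₀ ∖ □₁` has width `ρ = R₁M₁`; `k ≥ 1`). [cite: Balaban1985RegularSpaces, p.98 («a distance between boundaries of these cubes is equal to R₁M₁Lʲη»)] -/
theorem mem_cube_zero_of_near_cube_one {L : ℕ} (a : Fin (d + 1) → ℤ) (M : ℕ) {ρ k : ℕ} (hk : 1 ≤ k) {x τ : Fin (d + 1) → ℤ}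
    (hx : x ∈ cube L a M ρ k 1) {r : ℕ} (hr : r ≤ ρ) (hτ : ∀ i, |τ i| ≤ (r : ℤ)) : x + τ ∈ cube L a M ρ k 0 := by
  refine add_mem_cube_of_mem_succ (j := 0) (lt_of_lt_of_le Nat.zero_lt_one hk) hx fun i => (hτ i).trans ?_
  rw [pow_zero, mul_one]; exact_mod_cast hr

open Classical in
/-- **EVERY SITE IN THE SUPPORT OF A DEEP ROW HAS ITS NEIGHBOURS IN `□₀`**: if the `2`-ball of `x` lies in `□₀` (`x + τ ∈ □₀` for `|τ|_∞ ≤ 2`) then every `z` with `K(x,z) ≠ 0`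
(restriction sets = the truncation-`n` towers of the cube member) lies in `□₀` together with all its lattice neighbours (`ρ ≥ 1`, `1 ≤ n ≤ k`).
[cite: Balaban1985RegularSpaces, (1.91) p.91, (1.131) p.99, p.98] -/
theorem good_of_K_ne_zero {L : ℕ} (hL : 1 ≤ L) (a : Fin (d + 1) → ℤ) (M : ℕ) {ρ k n : ℕ} (hρ : L ≤ ρ) (hn1 : 1 ≤ n) (hn : n ≤ k)
    {η : ℝ} (w : ℕ → ℝ) (K : (Fin (d + 1) → ℤ) → (Fin (d + 1) → ℤ) → ℝ)
    (hK : ∀ x z, K x z = ((η ^ 2)⁻¹ * ∑ μ : Fin (d + 1), ((2 : ℝ) * (if z = x then (1 : ℝ) else 0) - (if z = x + e μ then (1 : ℝ) else 0)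
        - (if z = x - e μ then (1 : ℝ) else 0))) +
        (∑ j ∈ Finset.range (n + 1), (if blockMap (L ^ j) x ∈ cubeLamS L a M ρ k n j ∧ blockMap (L ^ j) z = blockMap (L ^ j) x then
          w j * ((((L : ℝ) ^ (d + 1))⁻¹) ^ j) ^ 2 else 0)))
    {x z : Fin (d + 1) → ℤ} (hx : ∀ τ : Fin (d + 1) → ℤ, (∀ i, |τ i| ≤ 2) → x + τ ∈ cube L a M ρ k 0) (h : K x z ≠ 0) :
    z ∈ cube L a M ρ k 0 ∧ ∀ μ : Fin (d + 1), z + e μ ∈ cube L a M ρ k 0 ∧ z - e μ ∈ cube L a M ρ k 0 := by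
  have hk : 1 ≤ k := hn1.trans hn
  have hρ1 : 1 ≤ ρ := hL.trans hρ
  -- a site within `|·|_∞ ≤ 1` of `x` is good
  have hnear : ∀ σ : Fin (d + 1) → ℤ, (∀ i, |σ i| ≤ 1) →
      x + σ ∈ cube L a M ρ k 0 ∧ ∀ μ : Fin (d + 1), x + σ + e μ ∈ cube L a M ρ k 0 ∧ x + σ - e μ ∈ cube L a M ρ k 0 := by
    intro σ hσ
    refine ⟨hx σ (fun i => (hσ i).trans (by norm_num)), fun μ => ⟨?_, ?_⟩⟩
    · rw [add_assoc]
      refine hx _ fun i => ?_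
      simp only [Pi.add_apply]
      exact (abs_add_le _ _).trans (by linarith [hσ i, abs_e_apply_le μ i])
    · rw [add_sub_assoc]
      refine hx _ fun i => ?_
      simp only [Pi.sub_apply]
      exact (abs_sub _ _).trans (by linarith [hσ i, abs_e_apply_le μ i])
  rcases K_support L n (cubeLamS L a M ρ k n) w K hK h with hzx | ⟨μ, hμ | hμ⟩ | ⟨j, hjn, hxj, hzj⟩
  · have := hnear 0 (fun i => by simp)
    rw [add_zero] at this; rw [hzx]; exact this
  · have := hnear (e μ) (fun i => abs_e_apply_le μ i)
    rw [hμ]; exact this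
  · have := hnear (-e μ) (fun i => by rw [Pi.neg_apply, abs_neg]; exact abs_e_apply_le μ i)
    rw [← sub_eq_add_neg] at this
    rw [hμ]; exact this
  · rcases Nat.eq_zero_or_pos j with hj0 | hjpos
    · -- level `0`: the block of `x` is `{x}`
      subst hj0
      have h0 : ∀ y : Fin (d + 1) → ℤ, blockMap (L ^ 0) y = y := fun y => by funext i; simp [blockMap]
      rw [h0, h0] at hzj
      have := hnear 0 (fun i => by simp)
      rw [add_zero] at this; rw [hzj]; exact this
    · -- level `j ≥ 1`: the block lies in `□_j ⊆ □₁`, a unit step stays in `□₀`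
      have hzcube : z ∈ cube L a M ρ k j := mem_cube_of_tower hL a M ρ (by rw [hzj]; exact hxj)
      have hsub := cubeFam_antitone hL a M hρ k hjpos
      rw [cubeFam_false_of_le _ a M ρ (hjn.trans hn), cubeFam_false_of_le _ a M ρ hk] at hsub
      have hz1 : z ∈ cube L a M ρ k 1 := hsub hzcube
      refine ⟨?_, fun μ => ⟨?_, ?_⟩⟩
      · have := mem_cube_zero_of_near_cube_one a M hk hz1 (r := 1) hρ1 (τ := 0) (fun i => by simp)
        rwa [add_zero] at this
      · exact mem_cube_zero_of_near_cube_one a M hk hz1 hρ1 (fun i => by exact_mod_cast abs_e_apply_le μ i)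
      · rw [sub_eq_add_neg]
        exact mem_cube_zero_of_near_cube_one a M hk hz1 hρ1 (fun i => by
          rw [Pi.neg_apply, abs_neg]; exact_mod_cast abs_e_apply_le μ i)

/-- **THE DICHOTOMY NEAR THE DIRICHLET WALL** (`ρ ≥ 4`, `k ≥ 1`): either the `2`-ball of `x` lies in `□₀`, or the `2`-ball of `x` misses `□₁` (then every row through `x`
only sees level-`0` sites).  From «a distance between boundaries of these cubes is equal to R₁M₁Lʲη»: a `2`-ball meeting `□₁` lies in `□₁ + [−4,4]^{d+1} ⊂ □₀`.
[cite: Balaban1985RegularSpaces, p.98, (1.131) p.99] -/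
theorem near_wall_dichotomy {L : ℕ} (a : Fin (d + 1) → ℤ) (M : ℕ) {ρ k : ℕ} (hk : 1 ≤ k) (hρ4 : 4 ≤ ρ) (x : Fin (d + 1) → ℤ) :
    (∀ τ : Fin (d + 1) → ℤ, (∀ i, |τ i| ≤ 2) → x + τ ∈ cube L a M ρ k 0) ∨
    (∀ z : Fin (d + 1) → ℤ, (∀ i, |z i - x i| ≤ 2) → z ∉ cube L a M ρ k 1) := by
  by_cases h : ∃ z : Fin (d + 1) → ℤ, (∀ i, |z i - x i| ≤ 2) ∧ z ∈ cube L a M ρ k 1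
  · left
    obtain ⟨z, hz, hz1⟩ := h
    intro τ hτ
    have e1 : x + τ = z + (x + τ - z) := by abel
    rw [e1]
    refine mem_cube_zero_of_near_cube_one a M hk hz1 (r := 4) hρ4 fun i => ?_
    simp only [Pi.add_apply, Pi.sub_apply]
    have h1 := hz i
    have h2 := hτ i
    rw [abs_le] at h1 h2 ⊢
    constructor <;> push_cast <;> linarith
  · right
    push Not at h
    exact fun z hz => h z hz

/-! ## §4 The tower letters `Q`, `Qᵀ` -/

/-- **A COLUMN OF `Qᵀ` HAS ONE TERM**: for a site `z` in the tower `p` (`Bʲ(z) = y_p`), `(Qᵀg)(z) = L^{−(d+1)j}·g(p)` — the towers of the cube member are disjoint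
(`towers_disjoint_cube`). [cite: Balaban1985RegularSpaces, (1.5)–(1.6) p.77, (1.31) p.81, (1.91) p.91] -/
theorem Qt_mulVec_eq {L : ℕ} (hL : 1 ≤ L) (a : Fin (d + 1) → ℤ) (M : ℕ) {ρ k n : ℕ} (hρ : L ≤ ρ) (hn : n ≤ k)
    (S : Finset (Fin (d + 1) → ℤ)) (hS : ∀ x, x ∈ S ↔ x ∈ cubeFam false L a M ρ k 0)
    (B : Finset (ℕ × (Fin (d + 1) → ℤ))) (hB : ∀ p, p ∈ B ↔ p.1 ≤ n ∧ p.2 ∈ cubeLamS L a M ρ k n p.1)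
    (Q : Matrix ↥B ↥S ℝ) (hQ : Q = Matrix.of (fun (p : ↥B) (z : ↥S) =>
      if blockMap (L ^ p.1.1) z.1 = p.1.2 then (((L : ℝ) ^ (d + 1))⁻¹) ^ p.1.1 else 0))
    (g : ↥B → ℝ) (z : ↥S) (p : ↥B) (hzp : blockMap (L ^ p.1.1) z.1 = p.1.2) :
    (Qᵀ *ᵥ g) z = (((L : ℝ) ^ (d + 1))⁻¹) ^ p.1.1 * g p := by
  rw [Matrix.mulVec, dotProduct, Finset.sum_eq_single p]
  · rw [Matrix.transpose_apply, hQ, Matrix.of_apply, if_pos hzp]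
  · intro p' _ hp'
    rw [Matrix.transpose_apply, hQ, Matrix.of_apply, if_neg, zero_mul]
    intro hc
    obtain ⟨hp1, hp2⟩ := (hB p.1).mp p.2
    obtain ⟨hp1', hp2'⟩ := (hB p'.1).mp p'.2
    obtain ⟨hjj, hyy⟩ := towers_disjoint_cube hL a M hρ hn p'.1.1 hp1' p.1.1 hp1 p'.1.2 hp2' p.1.2 hp2 z.1 ((hS z.1).mp z.2) hc hzp
    exact hp' (Subtype.ext (Prod.ext hjj hyy))
  · intro h; exact absurd (Finset.mem_univ _) h

/-- **A ROW OF `Q` IS THE NORMALISED BLOCK SUM**: `(Qf)(p) = L^{−(d+1)j}·Σ_{z ∈ S, Bʲ(z) = y_p} f(z)`. [cite: Balaban1985RegularSpaces, (1.31) p.81, (1.91) p.91; Balaban1984PropagatorsII, (2.14)–(2.15) p.225] -/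
theorem Q_mulVec_eq {L : ℕ} (S : Finset (Fin (d + 1) → ℤ)) (B : Finset (ℕ × (Fin (d + 1) → ℤ)))
    (Q : Matrix ↥B ↥S ℝ) (hQ : Q = Matrix.of (fun (p : ↥B) (z : ↥S) =>
      if blockMap (L ^ p.1.1) z.1 = p.1.2 then (((L : ℝ) ^ (d + 1))⁻¹) ^ p.1.1 else 0))
    (f : ↥S → ℝ) (p : ↥B) :
    (Q *ᵥ f) p = (((L : ℝ) ^ (d + 1))⁻¹) ^ p.1.1 * ∑ z ∈ Finset.univ.filter (fun z : ↥S => blockMap (L ^ p.1.1) z.1 = p.1.2), f z := by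
  classical
  rw [Matrix.mulVec, dotProduct, Finset.mul_sum, Finset.sum_filter]
  refine Finset.sum_congr rfl fun z _ => ?_
  rw [hQ, Matrix.of_apply]
  split_ifs <;> simp

/-- **AT A LEVEL-`0` TOWER THE ROW OF `Q` IS THE POINT EVALUATION**: `(Qf)(0, y) = f(y)` («(Q′₀λ)(x) = λ(x), x ∈ Λ₀»: the level-`0` block of `y` is `{y}`).
[cite: Balaban1984PropagatorsII, (2.14) p.225, (2.4) p.224 («B⁰(Λ₀) = Λ₀»); Balaban1985RegularSpaces, (1.131) p.99] -/
theorem Q_mulVec_level_zero {L : ℕ} (S : Finset (Fin (d + 1) → ℤ)) (B : Finset (ℕ × (Fin (d + 1) → ℤ)))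
    (Q : Matrix ↥B ↥S ℝ) (hQ : Q = Matrix.of (fun (p : ↥B) (z : ↥S) =>
      if blockMap (L ^ p.1.1) z.1 = p.1.2 then (((L : ℝ) ^ (d + 1))⁻¹) ^ p.1.1 else 0))
    (f : ↥S → ℝ) {y : Fin (d + 1) → ℤ} (hyS : y ∈ S) (hp : ((0 : ℕ), y) ∈ B) :
    (Q *ᵥ f) ⟨(0, y), hp⟩ = f ⟨y, hyS⟩ := by
  have h0 : ∀ z : Fin (d + 1) → ℤ, blockMap (L ^ 0) z = z := fun z => by funext i; simp [blockMap]
  rw [Matrix.mulVec, dotProduct, Finset.sum_eq_single ⟨y, hyS⟩]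
  · rw [hQ, Matrix.of_apply, if_pos (h0 y), pow_zero, one_mul]
  · intro z _ hz
    rw [hQ, Matrix.of_apply, if_neg, zero_mul]
    rw [h0]
    exact fun h => hz (Subtype.ext h)
  · intro h; exact absurd (Finset.mem_univ _) h

/-- At a level-`0` tower, `Qu = X` reads `u(y) = X(0, y)`: the constraint pins `u` on `Λ₀`. [cite: Balaban1985BackgroundPropagators, (3.22) p.394 («under the condition Q′λ = X»); Balaban1984PropagatorsII, (2.14) p.225] -/
theorem eq_of_Q_mulVec_eq_level_zero {L : ℕ} (S : Finset (Fin (d + 1) → ℤ)) (B : Finset (ℕ × (Fin (d + 1) → ℤ)))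
    (Q : Matrix ↥B ↥S ℝ) (hQ : Q = Matrix.of (fun (p : ↥B) (z : ↥S) =>
      if blockMap (L ^ p.1.1) z.1 = p.1.2 then (((L : ℝ) ^ (d + 1))⁻¹) ^ p.1.1 else 0))
    (u : ↥S → ℝ) (X : ↥B → ℝ) (hQu : Q *ᵥ u = X) {y : Fin (d + 1) → ℤ} (hyS : y ∈ S) (hp : ((0 : ℕ), y) ∈ B) :
    u ⟨y, hyS⟩ = X ⟨(0, y), hp⟩ := by
  rw [← Q_mulVec_level_zero S B Q hQ u hyS hp, hQu]

/-! ## §5 The rows of `T²` near the Dirichlet wall, by locality -/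

/-- A site outside `□₁` is in no restriction block of level `≥ 1`: its only tower is the level-`0` one. [cite: Balaban1985RegularSpaces, (1.5)–(1.6) p.77, (1.131) p.99] -/
theorem tower_level_zero_of_not_mem {L : ℕ} (hL : 1 ≤ L) (a : Fin (d + 1) → ℤ) (M : ℕ) {ρ k n j : ℕ} (hρ : L ≤ ρ) (hn : n ≤ k) (hjn : j ≤ n)
    {x : Fin (d + 1) → ℤ} (hx1 : x ∉ cube L a M ρ k 1) (hxj : blockMap (L ^ j) x ∈ cubeLamS L a M ρ k n j) : j = 0 := by
  by_contra hj0
  have hjpos : 1 ≤ j := Nat.pos_of_ne_zero hj0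
  have hk : 1 ≤ k := le_trans (hjpos.trans hjn) hn
  have hxcube : x ∈ cube L a M ρ k j := mem_cube_of_tower hL a M ρ hxj
  have hsub := cubeFam_antitone hL a M hρ k hjpos
  rw [cubeFam_false_of_le _ a M ρ (hjn.trans hn), cubeFam_false_of_le _ a M ρ hk] at hsub
  exact hx1 (hsub hxcube)

open Classical in
/-- The support of a row through a site off `□₁` is the site and its lattice neighbours. [cite: Balaban1985RegularSpaces, (1.91) p.91, (1.131) p.99] -/
theorem K_support_of_not_mem {L : ℕ} (hL : 1 ≤ L) (a : Fin (d + 1) → ℤ) (M : ℕ) {ρ k n : ℕ} (hρ : L ≤ ρ) (hn : n ≤ k)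
    {η : ℝ} (w : ℕ → ℝ) (K : (Fin (d + 1) → ℤ) → (Fin (d + 1) → ℤ) → ℝ)
    (hK : ∀ x z, K x z = ((η ^ 2)⁻¹ * ∑ μ : Fin (d + 1), ((2 : ℝ) * (if z = x then (1 : ℝ) else 0) - (if z = x + e μ then (1 : ℝ) else 0)
        - (if z = x - e μ then (1 : ℝ) else 0))) +
        (∑ j ∈ Finset.range (n + 1), (if blockMap (L ^ j) x ∈ cubeLamS L a M ρ k n j ∧ blockMap (L ^ j) z = blockMap (L ^ j) x then
          w j * ((((L : ℝ) ^ (d + 1))⁻¹) ^ j) ^ 2 else 0)))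
    {x z : Fin (d + 1) → ℤ} (hx1 : x ∉ cube L a M ρ k 1) (h : K x z ≠ 0) : ∀ i, |z i - x i| ≤ 1 := by
  intro i
  rcases K_support L n (cubeLamS L a M ρ k n) w K hK h with hzx | ⟨μ, hμ | hμ⟩ | ⟨j, hjn, hxj, hzj⟩
  · rw [hzx, sub_self, abs_zero]; exact zero_le_one
  · rw [hμ, Pi.add_apply, add_sub_cancel_left]; exact abs_e_apply_le μ i
  · rw [hμ, Pi.sub_apply, sub_sub_cancel_left, abs_neg]; exact abs_e_apply_le μ i
  · have hj0 := tower_level_zero_of_not_mem hL a M hρ hn hjn hx1 hxj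
    subst hj0
    have h0 : ∀ y : Fin (d + 1) → ℤ, blockMap (L ^ 0) y = y := fun y => by funext i; simp [blockMap]
    rw [h0, h0] at hzj
    rw [hzj, sub_self, abs_zero]; exact zero_le_one

open Classical in
/-- **THE ROWS OF `T²` NEAR THE DIRICHLET WALL, BY LOCALITY**: if the `2`-ball of `x ∈ □₀` misses `□₁` and `u` agrees with `X` on the level-`0` towers of that ball
(the constraint `Qu = X` at level `0`), then `|(T(Tu))(x)| ≤ ((4(d+1) + a_max)η⁻²)²·s` for `sup|X| ≤ s` — two row sums of F12 `flatKernel_rowAbs_le`; no inverse is met.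
This is the 𝒢-bound at the level-`0` towers within distance `2` of `∂□₀` (where `𝒢X = T²H′X` and `H′X = X`).
[cite: Balaban1985BackgroundPropagators, Theorem 3.2 (3.48) p.398, (3.22)–(3.25) p.394; Balaban1984PropagatorsII, (2.14) p.225 («(Q′₀λ)(x) = λ(x)»)] -/
theorem wall_rows_bound {L : ℕ} (hL : 1 ≤ L) (a : Fin (d + 1) → ℤ) (M : ℕ) {ρ : ℕ} (hρ : L ≤ ρ) {k n : ℕ} (hn : n ≤ k)
    {η : ℝ} (hη : η ≠ 0) (w : ℕ → ℝ) (hw0 : ∀ j, 0 ≤ w j) {amax : ℝ} (hamax0 : 0 ≤ amax)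
    (hamax : ∀ j, j ≤ n → w j * η ^ 2 * ((L : ℝ) ^ j) ^ 2 * ((((L : ℝ) ^ (d + 1)) ^ j))⁻¹ ≤ amax)
    (S : Finset (Fin (d + 1) → ℤ)) (hS : ∀ x, x ∈ S ↔ x ∈ cubeFam false L a M ρ k 0)
    (B : Finset (ℕ × (Fin (d + 1) → ℤ))) (hB : ∀ p, p ∈ B ↔ p.1 ≤ n ∧ p.2 ∈ cubeLamS L a M ρ k n p.1)
    (K : (Fin (d + 1) → ℤ) → (Fin (d + 1) → ℤ) → ℝ)
    (hK : ∀ x z, K x z = ((η ^ 2)⁻¹ * ∑ μ : Fin (d + 1), ((2 : ℝ) * (if z = x then (1 : ℝ) else 0) - (if z = x + e μ then (1 : ℝ) else 0)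
        - (if z = x - e μ then (1 : ℝ) else 0))) +
        (∑ j ∈ Finset.range (n + 1), (if blockMap (L ^ j) x ∈ cubeLamS L a M ρ k n j ∧ blockMap (L ^ j) z = blockMap (L ^ j) x then
          w j * ((((L : ℝ) ^ (d + 1))⁻¹) ^ j) ^ 2 else 0)))
    (T : Matrix ↥S ↥S ℝ) (hT : T = Matrix.of (fun x z : ↥S => K x.1 z.1))
    (hk : 1 ≤ k) (hn1 : 1 ≤ n)
    (u : ↥S → ℝ) (X : ↥B → ℝ) (s : ℝ) (hs : 0 ≤ s) (hXs : ∀ p, |X p| ≤ s)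
    (x : ↥S) (hfar : ∀ z : Fin (d + 1) → ℤ, (∀ i, |z i - x.1 i| ≤ 2) → z ∉ cube L a M ρ k 1)
    (hu0 : ∀ z : ↥S, (∀ i, |z.1 i - x.1 i| ≤ 2) → ∀ hp : ((0 : ℕ), z.1) ∈ B, u z = X ⟨(0, z.1), hp⟩) :
    |(T *ᵥ (T *ᵥ u)) x| ≤ ((4 * ((d : ℝ) + 1) + amax) * (η ^ 2)⁻¹) ^ 2 * s := by
  have hrow : ∀ y : ↥S, ∑ z ∈ S, |K y.1 z| ≤ (4 * ((d : ℝ) + 1) + amax) * (η ^ 2)⁻¹ :=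
    fun y => flatKernel_rowAbs_le hL a M hρ hn hη w hw0 hamax0 hamax S hS K hK y.2
  have hC0 : 0 ≤ (4 * ((d : ℝ) + 1) + amax) * (η ^ 2)⁻¹ := by positivity
  -- level-`0` membership of the sites of the ball
  have hmem0 : ∀ z : ↥S, (∀ i, |z.1 i - x.1 i| ≤ 2) → ((0 : ℕ), z.1) ∈ B := by
    intro z hz
    have hz0 : z.1 ∈ cube L a M ρ k 0 := by rw [← cubeFam_false_of_le _ a M ρ (Nat.zero_le k)]; exact (hS z.1).mp z.2
    refine (hB _).mpr ⟨Nat.zero_le n, ?_⟩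
    change z.1 ∈ cubeLamS L a M ρ k n 0
    rw [B8CubeMemberZd.cubeLamS_of_lt L a M ρ k hn1, B8CubeMemberZd.mem_cubeLam_zero_iff hL a M ρ hk]
    exact ⟨hz0, hfar z.1 hz⟩
  -- the inner rows: `|(Tu)(z)| ≤ C₀ s` for `z` within `1` of `x`
  have hinner : ∀ z : ↥S, (∀ i, |z.1 i - x.1 i| ≤ 1) → |(T *ᵥ u) z| ≤ (4 * ((d : ℝ) + 1) + amax) * (η ^ 2)⁻¹ * s := by
    intro z hz
    have hz1 : z.1 ∉ cube L a M ρ k 1 := hfar z.1 (fun i => (hz i).trans (by norm_num))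
    refine (abs_mulVec_le_rowAbs S K T hT u s z fun z' hz' => ?_).trans (mul_le_mul_of_nonneg_right (hrow z) hs)
    have hd1 := K_support_of_not_mem hL a M hρ hn w K hK hz1 hz'
    have hz'2 : ∀ i, |z'.1 i - x.1 i| ≤ 2 := fun i => by
      have e1 : z'.1 i - x.1 i = (z'.1 i - z.1 i) + (z.1 i - x.1 i) := by ring
      rw [e1]
      exact (abs_add_le _ _).trans (by linarith [hd1 i, hz i])
    rw [hu0 z' hz'2 (hmem0 z' hz'2)]
    exact hXs _
  -- the outer row
  have hx1 : x.1 ∉ cube L a M ρ k 1 := hfar x.1 (fun i => by rw [sub_self, abs_zero]; norm_num)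
  calc |(T *ᵥ (T *ᵥ u)) x| ≤ (∑ z ∈ S, |K x.1 z|) * ((4 * ((d : ℝ) + 1) + amax) * (η ^ 2)⁻¹ * s) :=
        abs_mulVec_le_rowAbs S K T hT (T *ᵥ u) _ x fun z hz => hinner z (K_support_of_not_mem hL a M hρ hn w K hK hx1 hz)
    _ ≤ (4 * ((d : ℝ) + 1) + amax) * (η ^ 2)⁻¹ * ((4 * ((d : ℝ) + 1) + amax) * (η ^ 2)⁻¹ * s) :=
        mul_le_mul_of_nonneg_right (hrow x) (by positivity)
    _ = ((4 * ((d : ℝ) + 1) + amax) * (η ^ 2)⁻¹) ^ 2 * s := by ring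

end Literature.MathematicalPhysics.QuantumFieldTheory.Balaban1983to89.B8Eq348CubeMemberKKT
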